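import Summits.NavierStokesRegularity.NavierStokesRegularity.Theorems.HeredityAtOne.Negative.AxialRayMean
import Literature.Analysis.FluidPDE.RadialQuotientSobolev
import Literature.Analysis.FluidPDE.CylindricalIntegration
import HarnessLib

/-!
# The energy–impulse–speed inequality `E ≤ ¼ · sup‖u‖ · ∫ (x × curl u)₃` (disprover g5 on item 19249)

Second of three files (`AxialRayMean` → `EnergyImpulseBound` → `CapStratumEnergyBound`). No definitions, no
named facts. Main results (`u ∈ C¹(ℝ³; ℝ³)`):

* `lintegral_axialRayMean_sq_le`, `integrable_axialRayMean_sq` — the axial ray mean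
  `α(x) = ∫₀¹ s u₂(scaleH s x) ds` of an `L²` field is `L²`, `∫ α² ≤ ∫ u₂²` (Jensen on `[0,1]`, Tonelli, and the
  horizontal change of variables `∫ G(scaleH s x) dx = s⁻² ∫ G` of `RadialQuotientSobolev`).
* `divergence_rayMean_smul_axialFlux` — for swirl-free divergence-free `u` and Saffman's axial impulse flux
  `G(y) = (y₀u₀ + y₁u₁) e₂ − y₀u₂ e₀ − y₁u₂ e₁` (`div G = (x × curl u)₃ − 2u₂`, tree
  `divergence_axialImpulseFlux_eq`): **`div (α G) = α · (x × curl u)₃ − ‖u‖²`**, by (P3) and (Ph) of `AxialRayMean`.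
* `integral_norm_sq_eq_integral_rayMean_mul_swirl_curl` — the EXACT ENERGY IDENTITY
  **`∫ ‖u‖² = ∫ α · (x × curl u)₃`** for swirl-free divergence-free `u ∈ C¹ ∩ L² ∩ L^∞` with
  `(x × curl u)₃ ∈ L¹` — the Cartesian form of Lamb's `T = π ρ ∫∫ ψ ω_θ dr dz` — proved as `∫ div (αG) = 0`
  through the tree's `PineauVicol2026.integral_divergence_eq_zero_of_integrable_div`
  (`‖αG‖/(1+|x|) ≤ 4|α|‖u‖ ≤ 2(α² + ‖u‖²) ∈ L¹`, `div (αG) ∈ L¹` since `|α| ≤ U/2`).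
* `kineticEnergy_le_quarter_speed_mul_integral_swirl_curl` — **`E(u) = ½∫‖u‖² ≤ ¼ · U · ∫ (x × curl u)₃`**
  whenever in addition `‖u‖ ≤ U` and `(x × curl u)₃ ≥ 0` (signed axial impulse density; for axisymmetric `u`,
  `(x × curl u)₃ = r ω_θ = r²·(ω_θ/r)`, so this is `E ≤ ½ · sup‖u‖ · P` with Choi's impulse `P = ½∫ r²(ω_θ/r)`).
  No axisymmetry is assumed. The constant is not attained: Hill's spherical vortex has `E = U∫(x×ω)₃/7`
  (`U = Ma²/3` its top speed, `∫(x×ω)₃ = 8πMa⁵/15`, `E = 40πM²a⁷/1575`), uniform-`ω_θ/r` tori reach `≈ 0.16`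
  (job:j272119, job:j272424).

References: P. G. Saffman, *Vortex Dynamics* (1992), §3.2 (3.2.8)–(3.2.11) [cite: Saffman1992, §3.2 eq. (3.2.11)];
K. Choi, CPAM (2024), §2.2 (impulse `P = ½∫r²ξ`, energy `E = ½∫ξ𝒢[ξ]`) [cite: Choi2023, §2.2];
H. Lamb, *Hydrodynamics*, 6th ed., §162 (energy of axisymmetric swirl-free motion through the stream function).
-/

noncomputable section

namespace Summit.NavierStokesRegularity.HeredityAtOneEnergyBound

open Set MeasureTheory Filter Topology Function
open scoped ContDiff ENNReal Topology
open Literature.Analysis Literature.Analysis.FluidPDE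

variable {u : EuclideanSpace ℝ (Fin 3) → EuclideanSpace ℝ (Fin 3)}

/-! ## The axial ray mean is square integrable -/

/-- Jensen on `[0,1]`: `(∫₀¹ h)² ≤ ∫₀¹ h²`. [folklore] -/
theorem sq_intervalIntegral_le (h : ℝ → ℝ) (hc : Continuous h) :
    (∫ s in (0 : ℝ)..1, h s) ^ 2 ≤ ∫ s in (0 : ℝ)..1, h s ^ 2 := by
  set c := ∫ s in (0 : ℝ)..1, h s with hc_def
  have h0 : 0 ≤ ∫ s in (0 : ℝ)..1, (h s - c) ^ 2 :=
    intervalIntegral.integral_nonneg zero_le_one fun s _ => sq_nonneg _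
  have e : ∀ s, (h s - c) ^ 2 = (h s ^ 2 - (2 * c) * h s) + c ^ 2 := fun s => by ring
  simp_rw [e] at h0
  have i1 : IntervalIntegrable (fun s => h s ^ 2) volume 0 1 := (hc.pow 2).intervalIntegrable 0 1
  have i2 : IntervalIntegrable (fun s => (2 * c) * h s) volume 0 1 :=
    (continuous_const.mul hc).intervalIntegrable 0 1
  rw [intervalIntegral.integral_add (i1.sub i2) intervalIntegrable_const,
    intervalIntegral.integral_sub i1 i2, intervalIntegral.integral_const_mul,
    intervalIntegral.integral_const, ← hc_def] at h0
  simp only [sub_zero, smul_eq_mul, one_mul] at h0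
  nlinarith [h0]

/-- `ofReal ∘ (·)²` of the ray-mean integrand is jointly continuous. [folklore] -/
theorem continuous_rayIntegrand_sq (hu : Continuous u) :
    Continuous fun p : EuclideanSpace ℝ (Fin 3) × ℝ =>
      ENNReal.ofReal ((p.2 * u (scaleH p.2 p.1) 2) ^ 2) := by
  have h1 : Continuous fun p : EuclideanSpace ℝ (Fin 3) × ℝ => u (scaleH p.2 p.1) 2 :=
    (continuous_apply 2).comp ((PiLp.continuous_ofLp 2 _).comp
      (hu.comp (contDiff_scaleH_uncurry (n := 0)).continuous))
  exact ENNReal.continuous_ofReal.comp ((continuous_snd.mul h1).pow 2)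

/-- **`L²` bound for the ray mean**: `∫ α² ≤ ∫ u₂²` (as extended integrals; Jensen, Tonelli and
the horizontal change of variables). [folklore] -/
theorem lintegral_axialRayMean_sq_le (hu : Continuous u) :
    ∫⁻ x, ENNReal.ofReal ((∫ s in (0 : ℝ)..1, s * u (scaleH s x) 2) ^ 2) ≤ ∫⁻ x, ENNReal.ofReal ((u x 2) ^ 2) := by
  set Λ := ∫⁻ x, ENNReal.ofReal ((u x 2) ^ 2) with hΛ
  have hG : Measurable fun x : EuclideanSpace ℝ (Fin 3) => ENNReal.ofReal ((u x 2) ^ 2) :=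
    (ENNReal.continuous_ofReal.comp (((continuous_apply 2).comp
      ((PiLp.continuous_ofLp 2 _).comp hu)).pow 2)).measurable
  -- pointwise Jensen, written as a set `lintegral` over `[0,1]`
  have hF : ∀ x, ENNReal.ofReal ((∫ s in (0 : ℝ)..1, s * u (scaleH s x) 2) ^ 2) ≤
      ∫⁻ s in Icc (0 : ℝ) 1, ENNReal.ofReal ((s * u (scaleH s x) 2) ^ 2) := fun x => by
    have hc : Continuous fun s : ℝ => s * u (scaleH s x) 2 :=
      continuous_id.mul (continuous_apply_comp_scaleH hu x 2)
    have hi : Integrable (fun s : ℝ => (s * u (scaleH s x) 2) ^ 2) (volume.restrict (Icc 0 1)) :=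
      (hc.pow 2).continuousOn.integrableOn_compact isCompact_Icc
    calc ENNReal.ofReal ((∫ s in (0 : ℝ)..1, s * u (scaleH s x) 2) ^ 2)
        ≤ ENNReal.ofReal (∫ s in (0 : ℝ)..1, (s * u (scaleH s x) 2) ^ 2) :=
          ENNReal.ofReal_le_ofReal (sq_intervalIntegral_le _ hc)
      _ = ∫⁻ s in Icc (0 : ℝ) 1, ENNReal.ofReal ((s * u (scaleH s x) 2) ^ 2) := by
          rw [intervalIntegral.integral_of_le zero_le_one, ← integral_Icc_eq_integral_Ioc,
            ofReal_integral_eq_lintegral_ofReal hi (ae_of_all _ fun s => sq_nonneg _)]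
  -- the inner integral at fixed `s ∈ [0,1]` is at most `Λ` (equal to it for `s ≠ 0`)
  have hinner : ∀ s ∈ Icc (0 : ℝ) 1,
      ∫⁻ x, ENNReal.ofReal ((s * u (scaleH s x) 2) ^ 2) ≤ Λ := fun s _ => by
    rcases eq_or_ne s 0 with h0 | h0
    · subst h0; simp
    have e1 : ∀ x : EuclideanSpace ℝ (Fin 3), ENNReal.ofReal ((s * u (scaleH s x) 2) ^ 2) =
        ENNReal.ofReal (s ^ 2) * ENNReal.ofReal ((u (scaleH s x) 2) ^ 2) := fun x => by
      rw [← ENNReal.ofReal_mul (sq_nonneg s), mul_pow]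
    simp_rw [e1]
    have hms : Measurable (scaleH s) :=
      ((contDiff_scaleH_uncurry (n := 0)).continuous.comp
        (continuous_id.prodMk continuous_const)).measurable
    have hm : Measurable fun x => ENNReal.ofReal ((u (scaleH s x) 2) ^ 2) := hG.comp hms
    rw [lintegral_const_mul (ENNReal.ofReal (s ^ 2)) hm,
      lintegral_comp_scaleH hG h0, abs_of_nonneg (inv_nonneg.mpr (sq_nonneg s)), ← mul_assoc,
      ← ENNReal.ofReal_mul (sq_nonneg s), mul_inv_cancel₀ (pow_ne_zero 2 h0), ENNReal.ofReal_one, one_mul]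
  calc ∫⁻ x, ENNReal.ofReal ((∫ s in (0 : ℝ)..1, s * u (scaleH s x) 2) ^ 2)
      ≤ ∫⁻ x, ∫⁻ s in Icc (0 : ℝ) 1, ENNReal.ofReal ((s * u (scaleH s x) 2) ^ 2) :=
        lintegral_mono hF
    _ = ∫⁻ s in Icc (0 : ℝ) 1, ∫⁻ x, ENNReal.ofReal ((s * u (scaleH s x) 2) ^ 2) :=
        lintegral_lintegral_swap (continuous_rayIntegrand_sq hu).measurable.aemeasurable
    _ ≤ ∫⁻ _ in Icc (0 : ℝ) 1, Λ := setLIntegral_mono measurable_const hinner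
    _ = Λ := by rw [setLIntegral_const, Real.volume_Icc, sub_zero, ENNReal.ofReal_one, mul_one]

/-- **The ray mean of an `L²` field is `L²`.** [folklore] -/
theorem integrable_axialRayMean_sq (hu : ContDiff ℝ 1 u) (hL2 : Integrable (fun x => ‖u x‖ ^ 2)) :
    Integrable (fun x => (∫ s in (0 : ℝ)..1, s * u (scaleH s x) 2) ^ 2) := by
  refine ⟨((contDiff_axialRayMean hu).continuous.pow 2).aestronglyMeasurable, ?_⟩
  have h1 : ∫⁻ x, ‖(∫ s in (0 : ℝ)..1, s * u (scaleH s x) 2) ^ 2‖ₑ = ∫⁻ x, ENNReal.ofReal ((∫ s in (0 : ℝ)..1, s * u (scaleH s x) 2) ^ 2) :=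
    lintegral_congr fun x => Real.enorm_of_nonneg (sq_nonneg _)
  have h2 : ∫⁻ x, ENNReal.ofReal ((u x 2) ^ 2) ≤ ∫⁻ x, ENNReal.ofReal (‖u x‖ ^ 2) :=
    lintegral_mono fun x => ENNReal.ofReal_le_ofReal (by
      rw [← sq_abs (u x 2)]
      exact pow_le_pow_left₀ (abs_nonneg _) (abs_apply_le_norm (u x) 2) 2)
  have h3 : ∫⁻ x, ENNReal.ofReal (‖u x‖ ^ 2) < ⊤ := by
    rw [← ofReal_integral_eq_lintegral_ofReal hL2 (ae_of_all _ fun x => by positivity)]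
    exact ENNReal.ofReal_lt_top
  show ∫⁻ x, ‖(∫ s in (0 : ℝ)..1, s * u (scaleH s x) 2) ^ 2‖ₑ < ⊤
  rw [h1]
  exact (((lintegral_axialRayMean_sq_le hu.continuous).trans h2).trans_lt h3)


/-! ## The energy identity `∫ ‖u‖² = ∫ α · (x × curl u)₃` -/

/-- Components of Saffman's axial impulse flux `G(y) = (y₀u₀ + y₁u₁) e₂ − y₀u₂ e₀ − y₁u₂ e₁`: `G₀ = −y₀u₂`.
[folklore] -/
theorem axialFlux_apply_zero (u : EuclideanSpace ℝ (Fin 3) → EuclideanSpace ℝ (Fin 3))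
    (y : EuclideanSpace ℝ (Fin 3)) :
    (((y 0 * u y 0 + y 1 * u y 1) • EuclideanSpace.single (2 : Fin 3) (1 : ℝ) - (y 0 * u y 2) • EuclideanSpace.single (0 : Fin 3) (1 : ℝ) - (y 1 * u y 2) • EuclideanSpace.single (1 : Fin 3) (1 : ℝ))) 0 = -(y 0 * u y 2) := by
  simp

/-- `G₁ = −y₁u₂`. [folklore] -/
theorem axialFlux_apply_one (u : EuclideanSpace ℝ (Fin 3) → EuclideanSpace ℝ (Fin 3))
    (y : EuclideanSpace ℝ (Fin 3)) :
    (((y 0 * u y 0 + y 1 * u y 1) • EuclideanSpace.single (2 : Fin 3) (1 : ℝ) - (y 0 * u y 2) • EuclideanSpace.single (0 : Fin 3) (1 : ℝ) - (y 1 * u y 2) • EuclideanSpace.single (1 : Fin 3) (1 : ℝ))) 1 = -(y 1 * u y 2) := by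
  simp

/-- `G₂ = y₀u₀ + y₁u₁`. [folklore] -/
theorem axialFlux_apply_two (u : EuclideanSpace ℝ (Fin 3) → EuclideanSpace ℝ (Fin 3))
    (y : EuclideanSpace ℝ (Fin 3)) :
    (((y 0 * u y 0 + y 1 * u y 1) • EuclideanSpace.single (2 : Fin 3) (1 : ℝ) - (y 0 * u y 2) • EuclideanSpace.single (0 : Fin 3) (1 : ℝ) - (y 1 * u y 2) • EuclideanSpace.single (1 : Fin 3) (1 : ℝ))) 2 = y 0 * u y 0 + y 1 * u y 1 := by
  simp

/-- `‖G(y)‖ ≤ 4‖y‖‖u(y)‖`. [folklore] -/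
theorem norm_axialFlux_le (u : EuclideanSpace ℝ (Fin 3) → EuclideanSpace ℝ (Fin 3))
    (y : EuclideanSpace ℝ (Fin 3)) : ‖(((y 0 * u y 0 + y 1 * u y 1) • EuclideanSpace.single (2 : Fin 3) (1 : ℝ) - (y 0 * u y 2) • EuclideanSpace.single (0 : Fin 3) (1 : ℝ) - (y 1 * u y 2) • EuclideanSpace.single (1 : Fin 3) (1 : ℝ)))‖ ≤ 4 * (‖y‖ * ‖u y‖) := by
  have hy0 : |y 0| ≤ ‖y‖ := abs_apply_le_norm y 0
  have hy1 : |y 1| ≤ ‖y‖ := abs_apply_le_norm y 1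
  have hv0 : |u y 0| ≤ ‖u y‖ := abs_apply_le_norm (u y) 0
  have hv1 : |u y 1| ≤ ‖u y‖ := abs_apply_le_norm (u y) 1
  have hv2 : |u y 2| ≤ ‖u y‖ := abs_apply_le_norm (u y) 2
  have hs : ∀ i : Fin 3, ‖(EuclideanSpace.single i (1 : ℝ) : EuclideanSpace ℝ (Fin 3))‖ = 1 :=
    fun i => by simp
  have hA : ‖(y 0 * u y 0 + y 1 * u y 1) • EuclideanSpace.single (2 : Fin 3) (1 : ℝ)‖ ≤
      2 * (‖y‖ * ‖u y‖) := by
    rw [norm_smul, hs, mul_one, Real.norm_eq_abs]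
    calc |y 0 * u y 0 + y 1 * u y 1| ≤ |y 0 * u y 0| + |y 1 * u y 1| := abs_add_le _ _
      _ = |y 0| * |u y 0| + |y 1| * |u y 1| := by rw [abs_mul, abs_mul]
      _ ≤ ‖y‖ * ‖u y‖ + ‖y‖ * ‖u y‖ := by gcongr
      _ = 2 * (‖y‖ * ‖u y‖) := by ring
  have hB : ‖(y 0 * u y 2) • EuclideanSpace.single (0 : Fin 3) (1 : ℝ)‖ ≤
      ‖y‖ * ‖u y‖ := by
    rw [norm_smul, hs, mul_one, Real.norm_eq_abs, abs_mul]; gcongr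
  have hC : ‖(y 1 * u y 2) • EuclideanSpace.single (1 : Fin 3) (1 : ℝ)‖ ≤
      ‖y‖ * ‖u y‖ := by
    rw [norm_smul, hs, mul_one, Real.norm_eq_abs, abs_mul]; gcongr
  calc ‖(((y 0 * u y 0 + y 1 * u y 1) • EuclideanSpace.single (2 : Fin 3) (1 : ℝ) - (y 0 * u y 2) • EuclideanSpace.single (0 : Fin 3) (1 : ℝ) - (y 1 * u y 2) • EuclideanSpace.single (1 : Fin 3) (1 : ℝ)))‖
      ≤ ‖(y 0 * u y 0 + y 1 * u y 1) • EuclideanSpace.single (2 : Fin 3) (1 : ℝ) -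
          (y 0 * u y 2) • EuclideanSpace.single (0 : Fin 3) (1 : ℝ)‖ +
        ‖(y 1 * u y 2) • EuclideanSpace.single (1 : Fin 3) (1 : ℝ)‖ :=
        norm_sub_le _ _
    _ ≤ (‖(y 0 * u y 0 + y 1 * u y 1) • EuclideanSpace.single (2 : Fin 3) (1 : ℝ)‖ +
          ‖(y 0 * u y 2) • EuclideanSpace.single (0 : Fin 3) (1 : ℝ)‖) +
        ‖(y 1 * u y 2) • EuclideanSpace.single (1 : Fin 3) (1 : ℝ)‖ := by
        gcongr; exact norm_sub_le _ _
    _ ≤ (2 * (‖y‖ * ‖u y‖) + ‖y‖ * ‖u y‖) + ‖y‖ * ‖u y‖ := by gcongr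
    _ = 4 * (‖y‖ * ‖u y‖) := by ring

/-- `G ∈ C¹` for `u ∈ C¹`. [folklore] -/
theorem contDiff_axialFlux (hu : ContDiff ℝ 1 u) : ContDiff ℝ 1 (fun y : EuclideanSpace ℝ (Fin 3) => (y 0 * u y 0 + y 1 * u y 1) • EuclideanSpace.single (2 : Fin 3) (1 : ℝ) - (y 0 * u y 2) • EuclideanSpace.single (0 : Fin 3) (1 : ℝ) - (y 1 * u y 2) • EuclideanSpace.single (1 : Fin 3) (1 : ℝ)) := by
  have hcoord : ∀ j : Fin 3, ContDiff ℝ 1 (fun y : EuclideanSpace ℝ (Fin 3) => y j) := fun j =>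
    (EuclideanSpace.proj j : EuclideanSpace ℝ (Fin 3) →L[ℝ] ℝ).contDiff
  have hvc : ∀ i : Fin 3, ContDiff ℝ 1 (fun y => u y i) := fun i => contDiff_apply_coord_vec3 hu i
  exact (((((hcoord 0).mul (hvc 0)).add ((hcoord 1).mul (hvc 1))).smul contDiff_const).sub
    (((hcoord 0).mul (hvc 2)).smul contDiff_const)).sub (((hcoord 1).mul (hvc 2)).smul contDiff_const)

/-- Divergence of a scalar multiple in coordinates: `div (a G) = a div G + Σⱼ ∂ⱼa · Gⱼ`.
[folklore] -/
theorem divergence_smul_eq {a : EuclideanSpace ℝ (Fin 3) → ℝ}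
    {G : EuclideanSpace ℝ (Fin 3) → EuclideanSpace ℝ (Fin 3)} {x : EuclideanSpace ℝ (Fin 3)}
    (ha : DifferentiableAt ℝ a x) (hG : DifferentiableAt ℝ G x) :
    VectorCalculus.divergence (fun y => a y • G y) x = a x * VectorCalculus.divergence G x +
      (fderiv ℝ a x (EuclideanSpace.single (0 : Fin 3) (1 : ℝ)) * G x 0 +
        fderiv ℝ a x (EuclideanSpace.single (1 : Fin 3) (1 : ℝ)) * G x 1 +
        fderiv ℝ a x (EuclideanSpace.single (2 : Fin 3) (1 : ℝ)) * G x 2) := by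
  have h := ha.hasFDerivAt.smul hG.hasFDerivAt
  rw [divergence_eq_sum_three, divergence_eq_sum_three,
    show (fun y => a y • G y) = a • G from rfl, h.fderiv]
  simp only [add_apply, smul_apply, ContinuousLinearMap.smulRight_apply, PiLp.add_apply,
    PiLp.smul_apply, smul_eq_mul]
  ring

/-- **The pointwise energy identity**: for a swirl-free divergence-free `u ∈ C¹` with ray mean
`α` and Saffman flux `G`, `div (α G) = α · (x × curl u)₃ − ‖u‖²`. [folklore] -/
theorem divergence_rayMean_smul_axialFlux (hu : ContDiff ℝ 1 u) (hdiv : VectorCalculus.IsDivFree u)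
    (hns : HasNoSwirl u) (x : EuclideanSpace ℝ (Fin 3)) :
    VectorCalculus.divergence (fun y => (∫ s in (0 : ℝ)..1, s * u (scaleH s y) 2) • (((y 0 * u y 0 + y 1 * u y 1) • EuclideanSpace.single (2 : Fin 3) (1 : ℝ) - (y 0 * u y 2) • EuclideanSpace.single (0 : Fin 3) (1 : ℝ) - (y 1 * u y 2) • EuclideanSpace.single (1 : Fin 3) (1 : ℝ)))) x =
      (∫ s in (0 : ℝ)..1, s * u (scaleH s x) 2) * swirl (FluidPDE.curl u) x - ‖u x‖ ^ 2 := by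
  have hαd := (contDiff_axialRayMean hu).differentiable one_ne_zero
  have hn3 : ‖u x‖ ^ 2 = u x 0 ^ 2 + u x 1 ^ 2 + u x 2 ^ 2 := by
    rw [EuclideanSpace.real_norm_sq_eq, Fin.sum_univ_three]
  rw [divergence_smul_eq (hαd x) (((contDiff_axialFlux hu).differentiable one_ne_zero) x),
    divergence_axialImpulseFlux_eq ((hu.differentiable one_ne_zero) x), axialFlux_apply_zero,
    axialFlux_apply_one, axialFlux_apply_two, hn3]
  obtain ⟨hu0, hu1⟩ := apply_horiz_eq hu hdiv hns x
  have hu2 := apply_two_eq hu x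
  have hlin : fderiv ℝ (fun x => ∫ s in (0 : ℝ)..1, s * u (scaleH s x) 2) x (((x 0) • EuclideanSpace.single (0 : Fin 3) (1 : ℝ) + (x 1) • EuclideanSpace.single (1 : Fin 3) (1 : ℝ))) =
      x 0 * fderiv ℝ (fun x => ∫ s in (0 : ℝ)..1, s * u (scaleH s x) 2) x (EuclideanSpace.single (0 : Fin 3) (1 : ℝ)) +
        x 1 * fderiv ℝ (fun x => ∫ s in (0 : ℝ)..1, s * u (scaleH s x) 2) x (EuclideanSpace.single (1 : Fin 3) (1 : ℝ)) := by
    simp only [map_add, map_smul, smul_eq_mul]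
  rw [hlin] at hu2
  rw [hu0, hu1, hu2]
  ring

/-- **Energy identity** (Lamb §162 `T = πρ∫∫ψω dx dϖ` in Cartesian form): for a swirl-free
divergence-free `u ∈ C¹ ∩ L² ∩ L^∞` with `(x × curl u)₃ ∈ L¹`,
`∫ ‖u‖² = ∫ α · (x × curl u)₃`, `α = ψ/r²` the axial ray mean. Proof: `∫ div (αG) = 0`
(tree `PineauVicol2026.integral_divergence_eq_zero_of_integrable_div`: `αG ∈ C¹`,
`‖αG‖/(1+|x|) ≤ 4|α|‖u‖ ∈ L¹`, `div (αG) ∈ L¹`). [cite: Saffman1992, §3.2 eq. (3.2.11)] -/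
theorem integral_norm_sq_eq_integral_rayMean_mul_swirl_curl (hu : ContDiff ℝ 1 u)
    (hdiv : VectorCalculus.IsDivFree u) (hns : HasNoSwirl u)
    (hL2 : Integrable (fun x => ‖u x‖ ^ 2)) {U : ℝ} (hU : ∀ x, ‖u x‖ ≤ U)
    (hint : Integrable (fun x => swirl (FluidPDE.curl u) x)) :
    ∫ x, ‖u x‖ ^ 2 = ∫ x, (∫ s in (0 : ℝ)..1, s * u (scaleH s x) 2) * swirl (FluidPDE.curl u) x := by
  have hαd : ContDiff ℝ 1 (fun x => ∫ s in (0 : ℝ)..1, s * u (scaleH s x) 2) := contDiff_axialRayMean hu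
  have hF : ContDiff ℝ 1 (fun y => (∫ s in (0 : ℝ)..1, s * u (scaleH s y) 2) • (((y 0 * u y 0 + y 1 * u y 1) • EuclideanSpace.single (2 : Fin 3) (1 : ℝ) - (y 0 * u y 2) • EuclideanSpace.single (0 : Fin 3) (1 : ℝ) - (y 1 * u y 2) • EuclideanSpace.single (1 : Fin 3) (1 : ℝ)))) := hαd.smul (contDiff_axialFlux hu)
  have hA := integrable_axialRayMean_sq hu hL2
  have hαs : Integrable (fun x => (∫ s in (0 : ℝ)..1, s * u (scaleH s x) 2) * swirl (FluidPDE.curl u) x) :=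
    hint.bdd_mul hαd.continuous.aestronglyMeasurable
      (ae_of_all _ fun x => (Real.norm_eq_abs _).trans_le
        ((abs_axialRayMean_le hu.continuous hU x).trans le_rfl))
  have hdivF : (fun x => VectorCalculus.divergence (fun y => (∫ s in (0 : ℝ)..1, s * u (scaleH s y) 2) • (((y 0 * u y 0 + y 1 * u y 1) • EuclideanSpace.single (2 : Fin 3) (1 : ℝ) - (y 0 * u y 2) • EuclideanSpace.single (0 : Fin 3) (1 : ℝ) - (y 1 * u y 2) • EuclideanSpace.single (1 : Fin 3) (1 : ℝ)))) x) =
      fun x => (∫ s in (0 : ℝ)..1, s * u (scaleH s x) 2) * swirl (FluidPDE.curl u) x - ‖u x‖ ^ 2 :=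
    funext fun x => divergence_rayMean_smul_axialFlux hu hdiv hns x
  have hdI : Integrable (fun x => VectorCalculus.divergence
      (fun y => (∫ s in (0 : ℝ)..1, s * u (scaleH s y) 2) • (((y 0 * u y 0 + y 1 * u y 1) • EuclideanSpace.single (2 : Fin 3) (1 : ℝ) - (y 0 * u y 2) • EuclideanSpace.single (0 : Fin 3) (1 : ℝ) - (y 1 * u y 2) • EuclideanSpace.single (1 : Fin 3) (1 : ℝ)))) x) := by
    rw [hdivF]; exact hαs.sub hL2
  have hwI : Integrable fun x => ‖(∫ s in (0 : ℝ)..1, s * u (scaleH s x) 2) • (((x 0 * u x 0 + x 1 * u x 1) • EuclideanSpace.single (2 : Fin 3) (1 : ℝ) - (x 0 * u x 2) • EuclideanSpace.single (0 : Fin 3) (1 : ℝ) - (x 1 * u x 2) • EuclideanSpace.single (1 : Fin 3) (1 : ℝ)))‖ / (1 + ‖x‖) := by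
    refine ((hA.add hL2).const_mul 2).mono' ?_ (Eventually.of_forall fun x => ?_)
    · exact ((hF.continuous.norm).div (continuous_const.add continuous_norm)
        fun x => (by positivity : (1 : ℝ) + ‖x‖ ≠ 0)).aestronglyMeasurable
    · have h1 : 0 < 1 + ‖x‖ := by positivity
      rw [Real.norm_of_nonneg (by positivity), div_le_iff₀ h1, norm_smul, Real.norm_eq_abs]
      calc |(∫ s in (0 : ℝ)..1, s * u (scaleH s x) 2)| * ‖(((x 0 * u x 0 + x 1 * u x 1) • EuclideanSpace.single (2 : Fin 3) (1 : ℝ) - (x 0 * u x 2) • EuclideanSpace.single (0 : Fin 3) (1 : ℝ) - (x 1 * u x 2) • EuclideanSpace.single (1 : Fin 3) (1 : ℝ)))‖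
          ≤ |(∫ s in (0 : ℝ)..1, s * u (scaleH s x) 2)| * (4 * (‖x‖ * ‖u x‖)) := by
            gcongr; exact norm_axialFlux_le u x
        _ = (2 * (2 * (|(∫ s in (0 : ℝ)..1, s * u (scaleH s x) 2)| * ‖u x‖))) * ‖x‖ := by ring
        _ ≤ (2 * ((∫ s in (0 : ℝ)..1, s * u (scaleH s x) 2) ^ 2 + ‖u x‖ ^ 2)) * ‖x‖ := by
            gcongr
            nlinarith [sq_nonneg (|(∫ s in (0 : ℝ)..1, s * u (scaleH s x) 2)| - ‖u x‖), sq_abs ((∫ s in (0 : ℝ)..1, s * u (scaleH s x) 2)),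
              norm_nonneg (u x), abs_nonneg ((∫ s in (0 : ℝ)..1, s * u (scaleH s x) 2))]
        _ ≤ 2 * ((∫ s in (0 : ℝ)..1, s * u (scaleH s x) 2) ^ 2 + ‖u x‖ ^ 2) * (1 + ‖x‖) := by
            nlinarith [sq_nonneg ((∫ s in (0 : ℝ)..1, s * u (scaleH s x) 2)), sq_nonneg ‖u x‖, norm_nonneg x]
  have h := PineauVicol2026.integral_divergence_eq_zero_of_integrable_div hF hwI hdI
  rw [hdivF, integral_sub hαs hL2] at h
  linarith

/-- **The energy–impulse–speed inequality.** For a swirl-free divergence-free field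
`u ∈ C¹ ∩ L²` with `sup ‖u‖ ≤ U` and SIGNED, integrable axial impulse density `(x × curl u)₃ ≥ 0`
(`= r ω_θ = r² · (ω_θ/r)` for axisymmetric `u`):
`E(u) = ½ ∫ ‖u‖² ≤ ¼ · U · ∫ (x × curl u)₃`, i.e. `E ≤ ½ · sup‖u‖ · P` with the impulse
`P = ½ ∫ r² (ω_θ/r)`. Equality of the underlying identity `2E = ∫ (ψ/r²) · r ω_θ`
(Lamb §162); the constant `¼` is attained asymptotically by no field but is approached to within
`4ε = 0.57` by Hill's vortex (`E / (U · ∫ r ω_θ) = 1/7`). [folklore] -/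
theorem kineticEnergy_le_quarter_speed_mul_integral_swirl_curl (hu : ContDiff ℝ 1 u)
    (hdiv : VectorCalculus.IsDivFree u) (hns : HasNoSwirl u)
    (hL2 : Integrable (fun x => ‖u x‖ ^ 2)) {U : ℝ} (hU : ∀ x, ‖u x‖ ≤ U)
    (hsign : ∀ x, 0 ≤ swirl (FluidPDE.curl u) x)
    (hint : Integrable (fun x => swirl (FluidPDE.curl u) x)) :
    VectorCalculus.kineticEnergy u ≤ U / 4 * ∫ x, swirl (FluidPDE.curl u) x := by
  have hαc : Continuous (fun x => ∫ s in (0 : ℝ)..1, s * u (scaleH s x) 2) := (contDiff_axialRayMean hu).continuous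
  have hαs : Integrable (fun x => (∫ s in (0 : ℝ)..1, s * u (scaleH s x) 2) * swirl (FluidPDE.curl u) x) :=
    hint.bdd_mul hαc.aestronglyMeasurable
      (ae_of_all _ fun x => (Real.norm_eq_abs _).trans_le (abs_axialRayMean_le hu.continuous hU x))
  have hmono : ∫ x, (∫ s in (0 : ℝ)..1, s * u (scaleH s x) 2) * swirl (FluidPDE.curl u) x ≤
      ∫ x, U / 2 * swirl (FluidPDE.curl u) x := by
    refine integral_mono hαs (hint.const_mul _) fun x => ?_
    have h1 := abs_axialRayMean_le hu.continuous hU x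
    have h2 := hsign x
    show (∫ s in (0 : ℝ)..1, s * u (scaleH s x) 2) * swirl (FluidPDE.curl u) x ≤ U / 2 * swirl (FluidPDE.curl u) x
    exact mul_le_mul_of_nonneg_right ((le_abs_self _).trans h1) h2
  rw [integral_const_mul] at hmono
  unfold VectorCalculus.kineticEnergy
  rw [integral_norm_sq_eq_integral_rayMean_mul_swirl_curl hu hdiv hns hL2 hU hint]
  nlinarith [hmono]

end Summit.NavierStokesRegularity.HeredityAtOneEnergyBound
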